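import Summits.ValiantsHypothesis.ValiantsHypothesis.Theorems.BarrierLeverPartitionMinorsHitByVPRoabpDoor

/-!
# Route BarrierLever — item `PartitionMinorsHitByVP` (stmt-ValiantsHypothesis-19717):
# the ONE-CUT SUB-BLOCK RANK BOUND for ROABP layout matrices (negative edge of the ROABP door, part 1)

Helper file (`--supports stmt-ValiantsHypothesis-19717`; cell valiant-natproofs, rung V4, 𝒟-side; prover seat val-np-p7 g15 on
director g8's word, after planner p1 g17's memo HOME/p1/g17/MEMO-roabp-refutation-g17.md §3/§7; the two rank lemmas are the
planner's checked text). Closes NO item.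

For ANY layout `(u, w)`, ANY reading order `π`, ANY width-`m` tables and ANY cut time `t₀`: the layout-matrix entry splits as
`K i j = ∑_{σ<m} (l ᵥ* Pre(u i, w j)) σ * (Suf(u i, w j) *ᵥ rr) σ` (`roabpCertMatrix_eq_sum_cut`), the prefix product `Pre` only
sees the coordinates read before `t₀` and the suffix product `Suf` only those read from `t₀` on (`preProd_eq_filter`,
`sufProd_eq_filter`). Hence, if `det K ≠ 0`, every `s` and every coordinate set `C` carrying all columns (`w j ⊆ C`):
* `choose_card_pre_le`: if `u` hits every `s`-subset of the `x`-coordinates read before `t₀`, then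
  `C(#X_pre, s) ≤ m · 2^{#(C ∩ Y_pre)}`;
* `choose_card_suf_le`: the mirror statement for the coordinates read from `t₀` on
(rows supported on one side factor through `Fin m ×` the column patterns on that side: `card_rows_le_of_patternedSum`).
Part 2 (`…RoabpDoorNegative.lean`) chooses thin rows × binary-code columns and a balanced cut to refute `ROABPHitsPartitionMinors`.

WHAT THIS IS NOT: nothing on item 19717 itself (general circuits are not read-once), nothing on crux 14610 or VP ≠ VNP.
-/

namespace Summit.ValiantsHypothesis.Theorems.BarrierLever.RoabpDoor

open Matrix Finset

/-! ## Two rank lemmas (planner p1 g17, checked) -/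

/-- **Patterned-sum rank lemma.** If every entry of `M` is `∑ σ < m, F σ i (pat j) * G σ j` — the row factor sees the column
only through a PATTERN `pat j ∈ β` — then `rank M ≤ m · |β|` (factor `M = A * B` through the index type `Fin m × β`). -/
theorem rank_le_of_patternedSum {ι κ β : Type*} [Fintype ι] [Fintype κ] [Fintype β]
    [DecidableEq β] {m : ℕ} (pat : κ → β) (F : Fin m → ι → β → ℂ) (G : Fin m → κ → ℂ)
    (M : Matrix ι κ ℂ) (hM : ∀ i j, M i j = ∑ σ, F σ i (pat j) * G σ j) :
    M.rank ≤ m * Fintype.card β := by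
  classical
  let A : Matrix ι (Fin m × β) ℂ := Matrix.of fun i p => F p.1 i p.2
  let B : Matrix (Fin m × β) κ ℂ := Matrix.of fun p j => if pat j = p.2 then G p.1 j else 0
  have hAB : M = A * B := by
    ext i j
    rw [hM, Matrix.mul_apply, Fintype.sum_prod_type]
    refine Finset.sum_congr rfl fun σ _ => ?_
    rw [Finset.sum_eq_single (pat j)]
    · simp [A, B]
    · intro b _ hb
      simp [A, B, Ne.symm hb]
    · intro h
      exact absurd (Finset.mem_univ _) h
  calc M.rank = (A * B).rank := by rw [hAB]
    _ ≤ A.rank := Matrix.rank_mul_le_left _ _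
    _ ≤ Fintype.card (Fin m × β) := Matrix.rank_le_card_width _
    _ = m * Fintype.card β := by simp [Fintype.card_prod]

/-- **Rows of a nonsingular matrix selected injectively have full rank.** -/
theorem rank_submatrix_eq_card_of_det_ne_zero {n ι : Type*} [Fintype n] [DecidableEq n]
    [Fintype ι] (K : Matrix n n ℂ) (hK : K.det ≠ 0) (e : ι → n) (he : Function.Injective e) :
    (K.submatrix e id).rank = Fintype.card ι := by
  have hli : LinearIndependent ℂ (K.submatrix e id).row :=
    (Matrix.linearIndependent_rows_of_det_ne_zero hK).comp e he
  rw [Matrix.rank_eq_finrank_span_row, finrank_span_eq_card hli]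

/-- A set `ι` of rows of a nonsingular matrix whose entries are patterned sums has `|ι| ≤ m · |β|`. -/
theorem card_rows_le_of_patternedSum {n ι β : Type*} [Fintype n] [DecidableEq n] [Fintype ι]
    [Fintype β] [DecidableEq β] {m : ℕ} (K : Matrix n n ℂ) (hK : K.det ≠ 0)
    (e : ι → n) (he : Function.Injective e) (pat : n → β) (F : Fin m → ι → β → ℂ)
    (G : Fin m → n → ℂ) (hM : ∀ i j, K (e i) j = ∑ σ, F σ i (pat j) * G σ j) :
    Fintype.card ι ≤ m * Fintype.card β := by
  rw [← rank_submatrix_eq_card_of_det_ne_zero K hK e he]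
  exact rank_le_of_patternedSum pat F G (K.submatrix e id) (fun i j => by simpa using hM i j)

/-! ## Splitting the layout matrix at a cut -/

variable {h m : ℕ}

/-- The table read at step `t` for the monomial `x^A y^B`. -/
noncomputable def stepMat (π : Equiv.Perm (Fin (h + h))) (P Q : Fin (h + h) → Matrix (Fin m) (Fin m) ℂ)
    (A B : Finset (Fin h)) (t : Fin (h + h)) : Matrix (Fin m) (Fin m) ℂ :=
  if π t ∈ monoVars h A B then Q t else P t

/-- The PREFIX product (steps `< t₀`) for the monomial `x^A y^B`. -/
noncomputable def preProd (π : Equiv.Perm (Fin (h + h))) (P Q : Fin (h + h) → Matrix (Fin m) (Fin m) ℂ)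
    (t₀ : ℕ) (A B : Finset (Fin h)) : Matrix (Fin m) (Fin m) ℂ :=
  ((List.ofFn (stepMat π P Q A B)).take t₀).prod

/-- The SUFFIX product (steps `≥ t₀`) for the monomial `x^A y^B`. -/
noncomputable def sufProd (π : Equiv.Perm (Fin (h + h))) (P Q : Fin (h + h) → Matrix (Fin m) (Fin m) ℂ)
    (t₀ : ℕ) (A B : Finset (Fin h)) : Matrix (Fin m) (Fin m) ℂ :=
  ((List.ofFn (stepMat π P Q A B)).drop t₀).prod

/-- **Entry split at the cut `t₀`.** `K i j = ∑_σ (l ᵥ* Pre) σ · (Suf *ᵥ rr) σ`. -/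
theorem roabpCertMatrix_eq_sum_cut {r : ℕ} (u w : Fin r → Finset (Fin h)) (π : Equiv.Perm (Fin (h + h)))
    (P Q : Fin (h + h) → Matrix (Fin m) (Fin m) ℂ) (l rr : Fin m → ℂ) (t₀ : ℕ) (i j : Fin r) :
    roabpCertMatrix u w π P Q l rr i j =
      ∑ σ, (l ᵥ* preProd π P Q t₀ (u i) (w j)) σ * (sufProd π P Q t₀ (u i) (w j) *ᵥ rr) σ := by
  rw [roabpCertMatrix, Matrix.of_apply]
  have : (List.ofFn fun t : Fin (h + h) => if π t ∈ monoVars h (u i) (w j) then Q t else P t).prod =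
      preProd π P Q t₀ (u i) (w j) * sufProd π P Q t₀ (u i) (w j) := by
    rw [preProd, sufProd, List.prod_take_mul_prod_drop]; rfl
  rw [this, ← Matrix.mulVec_mulVec, Matrix.dotProduct_mulVec]
  rfl

/-! ## Locality: the prefix sees only coordinates read before the cut, the suffix only those read after -/

/-- The step table at a time `t < t₀` only depends on the coordinates READ BEFORE `t₀`. -/
theorem stepMat_eq_filter_lt (π : Equiv.Perm (Fin (h + h))) (P Q : Fin (h + h) → Matrix (Fin m) (Fin m) ℂ)
    (A B : Finset (Fin h)) (t₀ : ℕ) (t : Fin (h + h)) (ht : (t : ℕ) < t₀) :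
    stepMat π P Q A B t = stepMat π P Q (A.filter fun a => (π.symm (Fin.castAdd h a) : ℕ) < t₀)
      (B.filter fun c => (π.symm (Fin.natAdd h c) : ℕ) < t₀) t := by
  classical
  unfold stepMat
  have hiff : π t ∈ monoVars h A B ↔ π t ∈ monoVars h (A.filter fun a => (π.symm (Fin.castAdd h a) : ℕ) < t₀)
      (B.filter fun c => (π.symm (Fin.natAdd h c) : ℕ) < t₀) := by
    simp only [monoVars, Finset.mem_union, Finset.mem_image, Finset.mem_filter]
    constructor
    · rintro (⟨a, ha, he⟩ | ⟨c, hc, he⟩)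
      · exact Or.inl ⟨a, ⟨ha, by rw [he, Equiv.symm_apply_apply]; exact ht⟩, he⟩
      · exact Or.inr ⟨c, ⟨hc, by rw [he, Equiv.symm_apply_apply]; exact ht⟩, he⟩
    · rintro (⟨a, ⟨ha, -⟩, he⟩ | ⟨c, ⟨hc, -⟩, he⟩)
      · exact Or.inl ⟨a, ha, he⟩
      · exact Or.inr ⟨c, hc, he⟩
  rw [if_congr hiff rfl rfl]

/-- The step table at a time `t ≥ t₀` only depends on the coordinates READ FROM `t₀` ON. -/
theorem stepMat_eq_filter_ge (π : Equiv.Perm (Fin (h + h))) (P Q : Fin (h + h) → Matrix (Fin m) (Fin m) ℂ)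
    (A B : Finset (Fin h)) (t₀ : ℕ) (t : Fin (h + h)) (ht : t₀ ≤ (t : ℕ)) :
    stepMat π P Q A B t = stepMat π P Q (A.filter fun a => t₀ ≤ (π.symm (Fin.castAdd h a) : ℕ))
      (B.filter fun c => t₀ ≤ (π.symm (Fin.natAdd h c) : ℕ)) t := by
  classical
  unfold stepMat
  have hiff : π t ∈ monoVars h A B ↔ π t ∈ monoVars h (A.filter fun a => t₀ ≤ (π.symm (Fin.castAdd h a) : ℕ))
      (B.filter fun c => t₀ ≤ (π.symm (Fin.natAdd h c) : ℕ)) := by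
    simp only [monoVars, Finset.mem_union, Finset.mem_image, Finset.mem_filter]
    constructor
    · rintro (⟨a, ha, he⟩ | ⟨c, hc, he⟩)
      · exact Or.inl ⟨a, ⟨ha, by rw [he, Equiv.symm_apply_apply]; exact ht⟩, he⟩
      · exact Or.inr ⟨c, ⟨hc, by rw [he, Equiv.symm_apply_apply]; exact ht⟩, he⟩
    · rintro (⟨a, ⟨ha, -⟩, he⟩ | ⟨c, ⟨hc, -⟩, he⟩)
      · exact Or.inl ⟨a, ha, he⟩
      · exact Or.inr ⟨c, hc, he⟩
  rw [if_congr hiff rfl rfl]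

/-- **Locality of the prefix product.** -/
theorem preProd_eq_filter (π : Equiv.Perm (Fin (h + h))) (P Q : Fin (h + h) → Matrix (Fin m) (Fin m) ℂ)
    (t₀ : ℕ) (A B : Finset (Fin h)) :
    preProd π P Q t₀ A B = preProd π P Q t₀ (A.filter fun a => (π.symm (Fin.castAdd h a) : ℕ) < t₀)
      (B.filter fun c => (π.symm (Fin.natAdd h c) : ℕ) < t₀) := by
  unfold preProd
  congr 1
  apply List.ext_getElem
  · simp
  · intro i h1 h2
    simp only [List.getElem_take, List.getElem_ofFn]
    simp only [List.length_take, List.length_ofFn] at h1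
    exact stepMat_eq_filter_lt π P Q A B t₀ _ (by simp only; omega)

/-- **Locality of the suffix product.** -/
theorem sufProd_eq_filter (π : Equiv.Perm (Fin (h + h))) (P Q : Fin (h + h) → Matrix (Fin m) (Fin m) ℂ)
    (t₀ : ℕ) (A B : Finset (Fin h)) :
    sufProd π P Q t₀ A B = sufProd π P Q t₀ (A.filter fun a => t₀ ≤ (π.symm (Fin.castAdd h a) : ℕ))
      (B.filter fun c => t₀ ≤ (π.symm (Fin.natAdd h c) : ℕ)) := by
  unfold sufProd
  congr 1
  apply List.ext_getElem
  · simp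
  · intro i h1 h2
    simp only [List.getElem_drop, List.getElem_ofFn]
    exact stepMat_eq_filter_ge π P Q A B t₀ _ (by simp only; omega)

/-! ## The one-cut sub-block rank bounds -/

/-- **One-cut sub-block rank bound, PREFIX side.** If `det K ≠ 0`, all columns live on the coordinate set `C`, and the rows
contain every `s`-subset of the `x`-coordinates read before `t₀`, then `C(#X_pre, s) ≤ m · 2^{#(C ∩ Y_pre)}`: the rows supported
before the cut factor through `Fin m ×` (column patterns before the cut). -/
theorem choose_card_pre_le {r : ℕ} (u w : Fin r → Finset (Fin h)) (π : Equiv.Perm (Fin (h + h)))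
    (P Q : Fin (h + h) → Matrix (Fin m) (Fin m) ℂ) (l rr : Fin m → ℂ)
    (hdet : (roabpCertMatrix u w π P Q l rr).det ≠ 0) (t₀ s : ℕ) (C : Finset (Fin h)) (hwC : ∀ j, w j ⊆ C)
    (hU : ∀ S : Finset (Fin h), S.card = s → (∀ a ∈ S, (π.symm (Fin.castAdd h a) : ℕ) < t₀) → ∃ i, u i = S) :
    Nat.choose (Finset.univ.filter fun a : Fin h => (π.symm (Fin.castAdd h a) : ℕ) < t₀).card s ≤
      m * 2 ^ (C.filter fun c => (π.symm (Fin.natAdd h c) : ℕ) < t₀).card := by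
  classical
  set Xpre := Finset.univ.filter fun a : Fin h => (π.symm (Fin.castAdd h a) : ℕ) < t₀ with hXpre
  set Cpre := C.filter fun c => (π.symm (Fin.natAdd h c) : ℕ) < t₀ with hCpre
  have hmemX : ∀ S : ↥(Xpre.powersetCard s), ∀ a ∈ (S : Finset (Fin h)),
      (π.symm (Fin.castAdd h a) : ℕ) < t₀ := by
    intro S a ha
    have hS := (Finset.mem_powersetCard.1 S.2).1 ha
    rw [hXpre, Finset.mem_filter] at hS
    exact hS.2
  have hex : ∀ S : ↥(Xpre.powersetCard s), ∃ i, u i = S := fun S =>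
    hU S (Finset.mem_powersetCard.1 S.2).2 (hmemX S)
  choose e he using hex
  have heinj : Function.Injective e := by
    intro S T hST
    apply Subtype.ext
    rw [← he S, ← he T, hST]
  let pat : Fin r → ↥(Cpre.powerset) := fun j => ⟨(w j).filter fun c => (π.symm (Fin.natAdd h c) : ℕ) < t₀,
    Finset.mem_powerset.2 (Finset.filter_subset_filter _ (hwC j))⟩
  let F : Fin m → ↥(Xpre.powersetCard s) → ↥(Cpre.powerset) → ℂ := fun σ S b =>
    (l ᵥ* preProd π P Q t₀ (S : Finset (Fin h)) (b : Finset (Fin h))) σ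
  let G : Fin m → Fin r → ℂ := fun σ j =>
    (sufProd π P Q t₀ ∅ ((w j).filter fun c => t₀ ≤ (π.symm (Fin.natAdd h c) : ℕ)) *ᵥ rr) σ
  have hM : ∀ S j, roabpCertMatrix u w π P Q l rr (e S) j = ∑ σ, F σ S (pat j) * G σ j := by
    intro S j
    rw [roabpCertMatrix_eq_sum_cut u w π P Q l rr t₀]
    have hpre : preProd π P Q t₀ (u (e S)) (w j) =
        preProd π P Q t₀ (S : Finset (Fin h)) (pat j : Finset (Fin h)) := by
      rw [preProd_eq_filter, he S, Finset.filter_true_of_mem (hmemX S)]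
    have hsuf : sufProd π P Q t₀ (u (e S)) (w j) =
        sufProd π P Q t₀ ∅ ((w j).filter fun c => t₀ ≤ (π.symm (Fin.natAdd h c) : ℕ)) := by
      rw [sufProd_eq_filter, he S, Finset.filter_false_of_mem fun a ha => not_le.2 (hmemX S a ha)]
    refine Finset.sum_congr rfl fun σ _ => ?_
    rw [hpre, hsuf]
  have hcard := card_rows_le_of_patternedSum (roabpCertMatrix u w π P Q l rr) hdet e heinj pat F G hM
  have hι : Fintype.card ↥(Xpre.powersetCard s) = Nat.choose Xpre.card s := by
    rw [Fintype.card_coe, Finset.card_powersetCard]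
  have hβ : Fintype.card ↥(Cpre.powerset) = 2 ^ Cpre.card := by
    rw [Fintype.card_coe, Finset.card_powerset]
  rw [hι, hβ] at hcard
  exact hcard

/-- **One-cut sub-block rank bound, SUFFIX side** (mirror image): if the rows contain every `s`-subset of the `x`-coordinates
read from `t₀` on, then `C(#X_suf, s) ≤ m · 2^{#(C ∩ Y_suf)}`. -/
theorem choose_card_suf_le {r : ℕ} (u w : Fin r → Finset (Fin h)) (π : Equiv.Perm (Fin (h + h)))
    (P Q : Fin (h + h) → Matrix (Fin m) (Fin m) ℂ) (l rr : Fin m → ℂ)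
    (hdet : (roabpCertMatrix u w π P Q l rr).det ≠ 0) (t₀ s : ℕ) (C : Finset (Fin h)) (hwC : ∀ j, w j ⊆ C)
    (hU : ∀ S : Finset (Fin h), S.card = s → (∀ a ∈ S, t₀ ≤ (π.symm (Fin.castAdd h a) : ℕ)) → ∃ i, u i = S) :
    Nat.choose (Finset.univ.filter fun a : Fin h => t₀ ≤ (π.symm (Fin.castAdd h a) : ℕ)).card s ≤
      m * 2 ^ (C.filter fun c => t₀ ≤ (π.symm (Fin.natAdd h c) : ℕ)).card := by
  classical
  set Xsuf := Finset.univ.filter fun a : Fin h => t₀ ≤ (π.symm (Fin.castAdd h a) : ℕ) with hXsuf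
  set Csuf := C.filter fun c => t₀ ≤ (π.symm (Fin.natAdd h c) : ℕ) with hCsuf
  have hmemX : ∀ S : ↥(Xsuf.powersetCard s), ∀ a ∈ (S : Finset (Fin h)),
      t₀ ≤ (π.symm (Fin.castAdd h a) : ℕ) := by
    intro S a ha
    have hS := (Finset.mem_powersetCard.1 S.2).1 ha
    rw [hXsuf, Finset.mem_filter] at hS
    exact hS.2
  have hex : ∀ S : ↥(Xsuf.powersetCard s), ∃ i, u i = S := fun S =>
    hU S (Finset.mem_powersetCard.1 S.2).2 (hmemX S)
  choose e he using hex
  have heinj : Function.Injective e := by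
    intro S T hST
    apply Subtype.ext
    rw [← he S, ← he T, hST]
  let pat : Fin r → ↥(Csuf.powerset) := fun j => ⟨(w j).filter fun c => t₀ ≤ (π.symm (Fin.natAdd h c) : ℕ),
    Finset.mem_powerset.2 (Finset.filter_subset_filter _ (hwC j))⟩
  let F : Fin m → ↥(Xsuf.powersetCard s) → ↥(Csuf.powerset) → ℂ := fun σ S b =>
    (sufProd π P Q t₀ (S : Finset (Fin h)) (b : Finset (Fin h)) *ᵥ rr) σ
  let G : Fin m → Fin r → ℂ := fun σ j =>
    (l ᵥ* preProd π P Q t₀ ∅ ((w j).filter fun c => (π.symm (Fin.natAdd h c) : ℕ) < t₀)) σ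
  have hM : ∀ S j, roabpCertMatrix u w π P Q l rr (e S) j = ∑ σ, F σ S (pat j) * G σ j := by
    intro S j
    rw [roabpCertMatrix_eq_sum_cut u w π P Q l rr t₀]
    have hpre : preProd π P Q t₀ (u (e S)) (w j) =
        preProd π P Q t₀ ∅ ((w j).filter fun c => (π.symm (Fin.natAdd h c) : ℕ) < t₀) := by
      rw [preProd_eq_filter, he S, Finset.filter_false_of_mem fun a ha => not_lt.2 (hmemX S a ha)]
    have hsuf : sufProd π P Q t₀ (u (e S)) (w j) =
        sufProd π P Q t₀ (S : Finset (Fin h)) (pat j : Finset (Fin h)) := by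
      rw [sufProd_eq_filter, he S, Finset.filter_true_of_mem (hmemX S)]
    refine Finset.sum_congr rfl fun σ _ => ?_
    rw [hpre, hsuf, mul_comm]
  have hcard := card_rows_le_of_patternedSum (roabpCertMatrix u w π P Q l rr) hdet e heinj pat F G hM
  have hι : Fintype.card ↥(Xsuf.powersetCard s) = Nat.choose Xsuf.card s := by
    rw [Fintype.card_coe, Finset.card_powersetCard]
  have hβ : Fintype.card ↥(Csuf.powerset) = 2 ^ Csuf.card := by
    rw [Fintype.card_coe, Finset.card_powerset]
  rw [hι, hβ] at hcard
  exact hcard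

end Summit.ValiantsHypothesis.Theorems.BarrierLever.RoabpDoor
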